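import Summits.ABC.ABC.Theorems.CuspFieldPencilGoldenFromNFPencil
import Literature.NumberTheory.DiophantineGeometry.MatveevYuPlaceBoundsNumberField
import Literature.IUT.LogVolume.PrincipalArithmeticDivisors
import HarnessLib

/-!
# STUB-IDEAS `stub_conjugateCuspTriple` — ideator k=2, GEN 4 (FAMILY 2: RESHAPE) — Sketch

Crux `GoldenCuspShadow` (stmt-ABC-26026), route `CuspFieldPencil`.  `Q = u² − 11uw − w²`,
`R = rad(uwQ)`, `H = max(|u|,|w|)`, `m = min(rad u, rad w)`, `q = rad Q`.

RESHAPE of the converged two-engine line (ℚ-engine `UWHalf` + K-engine Q-side datum):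

* **weaken-and-bootstrap (T1).** The stub AS TYPED needs only the WEAK K-datum
  `QSideRadSq : log H ≪ R^δ · q²` (because `min(m, q²) ≤ m^{2/3} q^{2/3}`), and `QSideRadSq` needs
  NO residue-degree / splitting lemma for `ℤ[φ]`: only `x₊·x̃₊ = Q`, `ord`-additivity, the product
  formula for the rational integer `Q`, and the GENERIC bound `Σ_{𝔭 ∋ n} N𝔭 ≤ rad(n)^{[K:ℚ]}`.
  Crux exponent `2/5` at this level (`twoFifths_of_uwHalf_qSideRadSq`); the `f = 1` lemma is only the
  upgrade `q² ↦ q`, `2/5 ↦ 1/3` (`third_of_uwHalf_qSideRad`).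
* **regime split with disjoint fact dependence (T2).** `|Q| ≤ √H`: Matveev-NF alone gives the ε-shape
  `log H ≪ R^δ` (`SmallQEps`); `|Q| ≥ √H`: Yu-NF alone gives `log H ≤ 2 log|Q| ≪ R^δ q²` (`LargeQSq`);
  `SmallQEps → LargeQSq → QSideRadSq` is proved below.
* **uniformise (T3).** The two K-place bounds are stated ONCE for any number field `K` and any fixed
  `α₀ ∈ K×` at `ξ = u/(α₀ v)` (`approx_nf_arch`, `approx_nf_padic`) — the number-field twin of
  `Pasten.approx_div`; the golden uses are instantiations (`α₀ = ω⁵`, `α₀ = (1 − ω)⁵`).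

Compositions `qSideRadSq_of_small_large`, `stub_of_uwHalf_qSideRadSq`, `crux_of_uwHalf`,
`twoFifths_of_uwHalf_qSideRadSq`, `third_of_uwHalf_qSideRad` and the cover lemma `min_le_geom` are
kernel-checked; helper statements carry `sorry` (this seat does not prove).
-/

noncomputable section

open Real NumberField UniqueFactorizationMonoid
open Literature.NumberTheory.DiophantineGeometry.Dioph

namespace Summit.ABC.ABC.Cruxes.GoldenCuspShadow.SideaK2G4

/-! ## §0 Statements (the stub verbatim; the graded K-data; the two ℚ/K engines' outputs) -/

/-- The registered stub `stub_conjugateCuspTriple`, verbatim. -/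
def StubConjugate : Prop :=
  ∀ ε : ℝ, 0 < ε → ∃ κ : ℝ, ∀ u w : ℤ, IsCoprime u w → u * w * (u ^ 2 - 11 * u * w - w ^ 2) ≠ 0 →
    Real.log (max (|(u : ℝ)|) (|(w : ℝ)|)) ≤
      κ * (((UniqueFactorizationMonoid.radical (u * w * (u ^ 2 - 11 * u * w - w ^ 2))).natAbs : ℕ) : ℝ) ^ (ε : ℝ) *
        ((((UniqueFactorizationMonoid.radical (u ^ 2 - 11 * u * w - w ^ 2)).natAbs : ℕ) : ℝ) ^ (2 / 3 : ℝ) *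
          (min (((UniqueFactorizationMonoid.radical u).natAbs : ℕ) : ℝ)
              (((UniqueFactorizationMonoid.radical w).natAbs : ℕ) : ℝ)) ^ (2 / 3 : ℝ))

/-- ℚ-engine output (Level 0, UNCONDITIONAL from `Summit.ABC.ABC.Theorems.approximationBound_rat_holds`;
owned by the k1/k2-g3 files): `log H ≤ κ_δ R^δ · min(rad u, rad w)`. -/
def UWHalf : Prop :=
  ∀ δ : ℝ, 0 < δ → ∃ κ : ℝ, ∀ u w : ℤ, IsCoprime u w → u * w * (u ^ 2 - 11 * u * w - w ^ 2) ≠ 0 →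
    Real.log (max (|(u : ℝ)|) (|(w : ℝ)|)) ≤
      κ * (((radical (u * w * (u ^ 2 - 11 * u * w - w ^ 2))).natAbs : ℕ) : ℝ) ^ (δ : ℝ) *
        min (((radical u).natAbs : ℕ) : ℝ) (((radical w).natAbs : ℕ) : ℝ)

/-- WEAK K-datum (Level 1; mod Matveev-NF + Yu-NF, NO splitting lemma): `log H ≤ κ_δ R^δ · rad(Q)²`. -/
def QSideRadSq : Prop :=
  ∀ δ : ℝ, 0 < δ → ∃ κ : ℝ, ∀ u w : ℤ, IsCoprime u w → u * w * (u ^ 2 - 11 * u * w - w ^ 2) ≠ 0 →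
    Real.log (max (|(u : ℝ)|) (|(w : ℝ)|)) ≤
      κ * (((radical (u * w * (u ^ 2 - 11 * u * w - w ^ 2))).natAbs : ℕ) : ℝ) ^ (δ : ℝ) *
        (((radical (u ^ 2 - 11 * u * w - w ^ 2)).natAbs : ℕ) : ℝ) ^ 2

/-- STRONG K-datum (Level 2 = k3-g3 `QSideRad`; needs the residue-degree lemma for `x₊`):
`log H ≤ κ_δ R^δ · rad(Q)`. -/
def QSideRad : Prop :=
  ∀ δ : ℝ, 0 < δ → ∃ κ : ℝ, ∀ u w : ℤ, IsCoprime u w → u * w * (u ^ 2 - 11 * u * w - w ^ 2) ≠ 0 →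
    Real.log (max (|(u : ℝ)|) (|(w : ℝ)|)) ≤
      κ * (((radical (u * w * (u ^ 2 - 11 * u * w - w ^ 2))).natAbs : ℕ) : ℝ) ^ (δ : ℝ) *
        (((radical (u ^ 2 - 11 * u * w - w ^ 2)).natAbs : ℕ) : ℝ)

/-- Regime IIa (mod Matveev-NF ONLY): on `|Q|² ≤ H` the golden pencil has ε-SHAPE quality. -/
def SmallQEps : Prop :=
  ∀ δ : ℝ, 0 < δ → ∃ κ : ℝ, ∀ u w : ℤ, IsCoprime u w → u * w * (u ^ 2 - 11 * u * w - w ^ 2) ≠ 0 →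
    (((u ^ 2 - 11 * u * w - w ^ 2).natAbs : ℕ) : ℝ) ^ 2 ≤ max (|(u : ℝ)|) (|(w : ℝ)|) →
    Real.log (max (|(u : ℝ)|) (|(w : ℝ)|)) ≤
      κ * (((radical (u * w * (u ^ 2 - 11 * u * w - w ^ 2))).natAbs : ℕ) : ℝ) ^ (δ : ℝ)

/-- Regime IIb (mod Yu-NF ONLY): on `H ≤ |Q|²`, `log H ≤ 2 log|Q| ≤ κ_δ R^δ rad(Q)²`. -/
def LargeQSq : Prop :=
  ∀ δ : ℝ, 0 < δ → ∃ κ : ℝ, ∀ u w : ℤ, IsCoprime u w → u * w * (u ^ 2 - 11 * u * w - w ^ 2) ≠ 0 →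
    max (|(u : ℝ)|) (|(w : ℝ)|) ≤ (((u ^ 2 - 11 * u * w - w ^ 2).natAbs : ℕ) : ℝ) ^ 2 →
    Real.log (max (|(u : ℝ)|) (|(w : ℝ)|)) ≤
      κ * (((radical (u * w * (u ^ 2 - 11 * u * w - w ^ 2))).natAbs : ℕ) : ℝ) ^ (δ : ℝ) *
        (((radical (u ^ 2 - 11 * u * w - w ^ 2)).natAbs : ℕ) : ℝ) ^ 2

/-- Crux shape with exponent `θ + ε`. `θ = 1/2` is `GoldenCuspShadow`; `2/5` = Level 1; `1/3` = Level 2. -/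
def GoldenExp (θ : ℝ) : Prop :=
  ∀ ε : ℝ, 0 < ε → ∃ κ : ℝ, ∀ u w : ℤ, IsCoprime u w → u * w * (u ^ 2 - 11 * u * w - w ^ 2) ≠ 0 →
    Real.log (max (|(u : ℝ)|) (|(w : ℝ)|)) ≤
      κ * (((radical (u * w * (u ^ 2 - 11 * u * w - w ^ 2))).natAbs : ℕ) : ℝ) ^ (θ + ε : ℝ)

/-- Sanity: `GoldenExp (1/2)` is literally the crux. -/
example : GoldenExp (1 / 2) = Summit.ABC.ABC.Theses.CuspFieldPencil.GoldenCuspShadow := rfl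

/-! ## §1 Real-arithmetic cover lemmas (PROVED) -/

/-- `min a b ≤ a^s b^t` for `s + t = 1`, `s, t ≥ 0`, `a, b ≥ 0`. -/
theorem min_le_geom {a b s t : ℝ} (ha : 0 ≤ a) (hb : 0 ≤ b) (hs : 0 ≤ s) (ht : 0 ≤ t)
    (hst : s + t = 1) : min a b ≤ a ^ s * b ^ t := by
  have hm0 : 0 ≤ min a b := le_min ha hb
  have hsplit : min a b = (min a b) ^ s * (min a b) ^ t := by
    rw [← Real.rpow_add' hm0 (by rw [hst]; norm_num), hst, Real.rpow_one]
  rw [hsplit]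
  exact mul_le_mul (Real.rpow_le_rpow hm0 (min_le_left a b) hs)
    (Real.rpow_le_rpow hm0 (min_le_right a b) ht) (Real.rpow_nonneg hm0 t) (Real.rpow_nonneg ha s)

/-- `min a b ≤ (a b)^{1/2}` for `a, b ≥ 0`. -/
theorem min_le_sqrt_mul {a b : ℝ} (ha : 0 ≤ a) (hb : 0 ≤ b) :
    min a b ≤ (a * b) ^ (1 / 2 : ℝ) := by
  have h := min_le_geom ha hb (s := 1 / 2) (t := 1 / 2) (by norm_num) (by norm_num) (by norm_num)
  rwa [← Real.mul_rpow ha hb] at h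

/-! ## §2 Kernel-checked compositions -/

/-- `R = rad u · rad w · rad Q` as reals (landed: `GoldenFromNFPencil.natAbs_radical_prod`). -/
theorem radR_eq {u w : ℤ} (huw : IsCoprime u w) :
    (((radical (u * w * (u ^ 2 - 11 * u * w - w ^ 2))).natAbs : ℕ) : ℝ) =
      (((radical u).natAbs : ℕ) : ℝ) * (((radical w).natAbs : ℕ) : ℝ) *
        (((radical (u ^ 2 - 11 * u * w - w ^ 2)).natAbs : ℕ) : ℝ) := by
  rw [Summit.ABC.ABC.Theorems.GoldenFromNFPencil.natAbs_radical_prod huw]; push_cast; ring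

/-- `1 ≤ rad n` as a real. -/
theorem one_le_radR (n : ℤ) : (1 : ℝ) ≤ (((radical n).natAbs : ℕ) : ℝ) := by
  have : (radical n).natAbs ≠ 0 := Int.natAbs_ne_zero.mpr radical_ne_zero
  exact_mod_cast Nat.one_le_iff_ne_zero.mpr this


/-- T2: the two single-fact regimes glue to the weak K-datum. -/
theorem qSideRadSq_of_small_large (hS : SmallQEps) (hL : LargeQSq) : QSideRadSq := by
  intro δ hδ
  obtain ⟨κ₁, h₁⟩ := hS δ hδ
  obtain ⟨κ₂, h₂⟩ := hL δ hδ
  refine ⟨max (max κ₁ κ₂) 0, fun u w huw h0 => ?_⟩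
  have hA := h₁ u w huw h0
  have hB := h₂ u w huw h0
  have hq1 := one_le_radR (u ^ 2 - 11 * u * w - w ^ 2)
  generalize hR : (((radical (u * w * (u ^ 2 - 11 * u * w - w ^ 2))).natAbs : ℕ) : ℝ) = R at *
  generalize hq : (((radical (u ^ 2 - 11 * u * w - w ^ 2)).natAbs : ℕ) : ℝ) = q at *
  generalize hN : (((u ^ 2 - 11 * u * w - w ^ 2).natAbs : ℕ) : ℝ) = N at *
  generalize hH : max (|(u : ℝ)|) (|(w : ℝ)|) = H at *
  have hR0 : 0 ≤ R := by rw [← hR]; exact Nat.cast_nonneg _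
  have hRe : 0 ≤ R ^ (δ : ℝ) := Real.rpow_nonneg hR0 _
  have hκ0 : (0 : ℝ) ≤ max (max κ₁ κ₂) 0 := le_max_right _ _
  have hk1 : κ₁ ≤ max (max κ₁ κ₂) 0 := (le_max_left κ₁ κ₂).trans (le_max_left (max κ₁ κ₂) 0)
  have hk2 : κ₂ ≤ max (max κ₁ κ₂) 0 := (le_max_right κ₁ κ₂).trans (le_max_left (max κ₁ κ₂) 0)
  have hq2 : (1 : ℝ) ≤ q ^ 2 := by nlinarith
  rcases le_total (N ^ 2) H with hsm | hlg
  · have h := hA hsm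
    calc Real.log H ≤ κ₁ * R ^ (δ : ℝ) := h
      _ ≤ max (max κ₁ κ₂) 0 * R ^ (δ : ℝ) := mul_le_mul_of_nonneg_right hk1 hRe
      _ = max (max κ₁ κ₂) 0 * R ^ (δ : ℝ) * 1 := (mul_one _).symm
      _ ≤ max (max κ₁ κ₂) 0 * R ^ (δ : ℝ) * q ^ 2 :=
          mul_le_mul_of_nonneg_left hq2 (mul_nonneg hκ0 hRe)
  · have h := hB hlg
    calc Real.log H ≤ κ₂ * R ^ (δ : ℝ) * q ^ 2 := h
      _ ≤ max (max κ₁ κ₂) 0 * R ^ (δ : ℝ) * q ^ 2 :=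
          mul_le_mul_of_nonneg_right (mul_le_mul_of_nonneg_right hk2 hRe) (by positivity)

/-- T1, the point of this file: the WEAK K-datum and the ℚ-engine give the stub AS TYPED on every
regime, via `min(m, q²) ≤ m^{2/3} (q²)^{1/3}`. -/
theorem stub_of_uwHalf_qSideRadSq (h1 : UWHalf) (h2 : QSideRadSq) : StubConjugate := by
  intro ε hε
  obtain ⟨κ₁, hκ₁⟩ := h1 ε hε
  obtain ⟨κ₂, hκ₂⟩ := h2 ε hε
  refine ⟨max (max κ₁ κ₂) 0, fun u w huw h0 => ?_⟩
  have hA := hκ₁ u w huw h0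
  have hB := hκ₂ u w huw h0
  -- names
  generalize hR : (((radical (u * w * (u ^ 2 - 11 * u * w - w ^ 2))).natAbs : ℕ) : ℝ) = R at *
  generalize hq : (((radical (u ^ 2 - 11 * u * w - w ^ 2)).natAbs : ℕ) : ℝ) = q at *
  generalize ha : (((radical u).natAbs : ℕ) : ℝ) = a at *
  generalize hb : (((radical w).natAbs : ℕ) : ℝ) = b at *
  generalize hL : Real.log (max (|(u : ℝ)|) (|(w : ℝ)|)) = L at *
  have hR0 : 0 ≤ R := by rw [← hR]; exact Nat.cast_nonneg _
  have hq0 : 0 ≤ q := by rw [← hq]; exact Nat.cast_nonneg _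
  have ha0 : 0 ≤ a := by rw [← ha]; exact Nat.cast_nonneg _
  have hb0 : 0 ≤ b := by rw [← hb]; exact Nat.cast_nonneg _
  have hm0 : 0 ≤ min a b := le_min ha0 hb0
  have hRe : 0 ≤ R ^ (ε : ℝ) := Real.rpow_nonneg hR0 _
  set κ : ℝ := max (max κ₁ κ₂) 0 with hκ
  have hκ0 : 0 ≤ κ := le_max_right _ _
  have hκR : 0 ≤ κ * R ^ (ε : ℝ) := mul_nonneg hκ0 hRe
  have hA' : L ≤ κ * R ^ (ε : ℝ) * min a b :=
    hA.trans (mul_le_mul_of_nonneg_right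
      (mul_le_mul_of_nonneg_right ((le_max_left κ₁ κ₂).trans (le_max_left (max κ₁ κ₂) 0)) hRe) hm0)
  have hB' : L ≤ κ * R ^ (ε : ℝ) * q ^ 2 :=
    hB.trans (mul_le_mul_of_nonneg_right
      (mul_le_mul_of_nonneg_right ((le_max_right κ₁ κ₂).trans (le_max_left (max κ₁ κ₂) 0)) hRe) (by positivity))
  have hmin : L ≤ κ * R ^ (ε : ℝ) * min (min a b) (q ^ 2) := by
    rcases le_total (min a b) (q ^ 2) with h | h
    · rw [min_eq_left h]; exact hA'
    · rw [min_eq_right h]; exact hB'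
  have hgeom : min (min a b) (q ^ 2) ≤ (min a b) ^ (2 / 3 : ℝ) * (q ^ 2) ^ (1 / 3 : ℝ) :=
    min_le_geom hm0 (by positivity) (by norm_num) (by norm_num) (by norm_num)
  have hq23 : (q ^ 2) ^ (1 / 3 : ℝ) = q ^ (2 / 3 : ℝ) := by
    rw [show q ^ 2 = q ^ (2 : ℝ) by norm_cast, ← Real.rpow_mul hq0]; norm_num
  calc L ≤ κ * R ^ (ε : ℝ) * min (min a b) (q ^ 2) := hmin
    _ ≤ κ * R ^ (ε : ℝ) * ((min a b) ^ (2 / 3 : ℝ) * (q ^ 2) ^ (1 / 3 : ℝ)) :=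
        mul_le_mul_of_nonneg_left hgeom hκR
    _ = κ * R ^ (ε : ℝ) * (q ^ (2 / 3 : ℝ) * (min a b) ^ (2 / 3 : ℝ)) := by rw [hq23]; ring

/-- Shared endgame of the exponent corollaries: from `log H ≤ κ R^ε · X` with `0 ≤ X ≤ R^θ`
conclude the `GoldenExp θ` shape with constant `max κ 0`. -/
theorem exp_step {L κ R X ε θ : ℝ} (hR : 0 ≤ R) (hX0 : 0 ≤ X) (hL : L ≤ κ * R ^ (ε : ℝ) * X)
    (hX : X ≤ R ^ θ) (hθε : θ + ε ≠ 0) : L ≤ max κ 0 * R ^ (θ + ε : ℝ) := by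
  have hRe : 0 ≤ R ^ (ε : ℝ) := Real.rpow_nonneg hR _
  calc L ≤ κ * R ^ (ε : ℝ) * X := hL
    _ ≤ max κ 0 * R ^ (ε : ℝ) * X :=
        mul_le_mul_of_nonneg_right (mul_le_mul_of_nonneg_right (le_max_left _ _) hRe) hX0
    _ ≤ max κ 0 * R ^ (ε : ℝ) * R ^ θ :=
        mul_le_mul_of_nonneg_left hX (mul_nonneg (le_max_right _ _) hRe)
    _ = max κ 0 * R ^ (θ + ε : ℝ) := by
        rw [mul_assoc, ← Real.rpow_add' hR (by rwa [add_comm] at hθε), add_comm]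

/-- Level 0 (UNCONDITIONAL once `UWHalf` lands): the ℚ-engine alone closes the CRUX
(`min(rad u, rad w) ≤ (rad u · rad w)^{1/2} ≤ R^{1/2}`). -/
theorem crux_of_uwHalf (h1 : UWHalf) : Summit.ABC.ABC.Theses.CuspFieldPencil.GoldenCuspShadow := by
  intro ε hε
  obtain ⟨κ, hκ⟩ := h1 ε hε
  refine ⟨max κ 0, fun u w huw h0 => ?_⟩
  have hA := hκ u w huw h0
  have hRabq := radR_eq huw
  have hq1 := one_le_radR (u ^ 2 - 11 * u * w - w ^ 2)
  generalize hR : (((radical (u * w * (u ^ 2 - 11 * u * w - w ^ 2))).natAbs : ℕ) : ℝ) = R at *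
  generalize hq : (((radical (u ^ 2 - 11 * u * w - w ^ 2)).natAbs : ℕ) : ℝ) = q at *
  generalize ha : (((radical u).natAbs : ℕ) : ℝ) = a at *
  generalize hb : (((radical w).natAbs : ℕ) : ℝ) = b at *
  have ha0 : 0 ≤ a := by rw [← ha]; exact Nat.cast_nonneg _
  have hb0 : 0 ≤ b := by rw [← hb]; exact Nat.cast_nonneg _
  have hR0 : 0 ≤ R := by rw [← hR]; exact Nat.cast_nonneg _
  have hab : a * b ≤ R := by
    rw [hRabq]
    have : 0 ≤ a * b := mul_nonneg ha0 hb0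
    nlinarith
  have hX : min a b ≤ R ^ (1 / 2 : ℝ) :=
    (min_le_sqrt_mul ha0 hb0).trans (Real.rpow_le_rpow (mul_nonneg ha0 hb0) hab (by norm_num))
  exact exp_step hR0 (le_min ha0 hb0) hA hX (by linarith)

/-- Level 1: `UWHalf ∧ QSideRadSq ⇒` crux exponent `2/5`
(`min(m, q²) ≤ m^{4/5} q^{2/5} ≤ (m² q)^{2/5} ≤ R^{2/5}`). -/
theorem twoFifths_of_uwHalf_qSideRadSq (h1 : UWHalf) (h2 : QSideRadSq) : GoldenExp (2 / 5) := by
  intro ε hε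
  obtain ⟨κ₁, hκ₁⟩ := h1 ε hε
  obtain ⟨κ₂, hκ₂⟩ := h2 ε hε
  refine ⟨max (max (max κ₁ κ₂) 0) 0, fun u w huw h0 => ?_⟩
  have hA := hκ₁ u w huw h0
  have hB := hκ₂ u w huw h0
  have hRabq := radR_eq huw
  generalize hR : (((radical (u * w * (u ^ 2 - 11 * u * w - w ^ 2))).natAbs : ℕ) : ℝ) = R at *
  generalize hq : (((radical (u ^ 2 - 11 * u * w - w ^ 2)).natAbs : ℕ) : ℝ) = q at *
  generalize ha : (((radical u).natAbs : ℕ) : ℝ) = a at *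
  generalize hb : (((radical w).natAbs : ℕ) : ℝ) = b at *
  generalize hL : Real.log (max (|(u : ℝ)|) (|(w : ℝ)|)) = L at *
  have ha0 : 0 ≤ a := by rw [← ha]; exact Nat.cast_nonneg _
  have hb0 : 0 ≤ b := by rw [← hb]; exact Nat.cast_nonneg _
  have hq0 : 0 ≤ q := by rw [← hq]; exact Nat.cast_nonneg _
  have hR0 : 0 ≤ R := by rw [← hR]; exact Nat.cast_nonneg _
  have hm0 : 0 ≤ min a b := le_min ha0 hb0
  have hRe : 0 ≤ R ^ (ε : ℝ) := Real.rpow_nonneg hR0 _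
  set κ : ℝ := max (max κ₁ κ₂) 0 with hκ
  have hκ0 : 0 ≤ κ := le_max_right _ _
  have hA' : L ≤ κ * R ^ (ε : ℝ) * min a b :=
    hA.trans (mul_le_mul_of_nonneg_right
      (mul_le_mul_of_nonneg_right ((le_max_left κ₁ κ₂).trans (le_max_left (max κ₁ κ₂) 0)) hRe) hm0)
  have hB' : L ≤ κ * R ^ (ε : ℝ) * q ^ 2 :=
    hB.trans (mul_le_mul_of_nonneg_right
      (mul_le_mul_of_nonneg_right ((le_max_right κ₁ κ₂).trans (le_max_left (max κ₁ κ₂) 0)) hRe) (by positivity))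
  have hmin : L ≤ κ * R ^ (ε : ℝ) * min (min a b) (q ^ 2) := by
    rcases le_total (min a b) (q ^ 2) with h | h
    · rw [min_eq_left h]; exact hA'
    · rw [min_eq_right h]; exact hB'
  -- `min(m, q²) ≤ m^{4/5} (q²)^{1/5}` and `m^{4/5} (q²)^{1/5} ≤ R^{2/5}`
  have hgeom : min (min a b) (q ^ 2) ≤ (min a b) ^ (4 / 5 : ℝ) * (q ^ 2) ^ (1 / 5 : ℝ) :=
    min_le_geom hm0 (by positivity) (by norm_num) (by norm_num) (by norm_num)
  have hmm : min a b * min a b ≤ a * b :=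
    mul_le_mul (min_le_left a b) (min_le_right a b) hm0 ha0
  have h45 : (min a b) ^ (4 / 5 : ℝ) ≤ (a * b) ^ (2 / 5 : ℝ) := by
    rw [show (4 / 5 : ℝ) = 2 * (2 / 5) by norm_num, Real.rpow_mul hm0,
      show (min a b) ^ (2 : ℝ) = min a b * min a b by rw [Real.rpow_two, sq]]
    exact Real.rpow_le_rpow (mul_nonneg hm0 hm0) hmm (by norm_num)
  have hq25 : (q ^ 2) ^ (1 / 5 : ℝ) = q ^ (2 / 5 : ℝ) := by
    rw [show q ^ 2 = q ^ (2 : ℝ) by norm_cast, ← Real.rpow_mul hq0]; norm_num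
  have hX : min (min a b) (q ^ 2) ≤ R ^ (2 / 5 : ℝ) := by
    calc min (min a b) (q ^ 2) ≤ (min a b) ^ (4 / 5 : ℝ) * (q ^ 2) ^ (1 / 5 : ℝ) := hgeom
      _ ≤ (a * b) ^ (2 / 5 : ℝ) * q ^ (2 / 5 : ℝ) := by
          rw [hq25]
          exact mul_le_mul_of_nonneg_right h45 (Real.rpow_nonneg hq0 _)
      _ = R ^ (2 / 5 : ℝ) := by
          rw [← Real.mul_rpow (mul_nonneg ha0 hb0) hq0, hRabq]
  exact exp_step hR0 (le_min hm0 (by positivity)) hmin hX (by linarith)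

/-- Level 2: `UWHalf ∧ QSideRad ⇒` crux exponent `1/3` (= k3-g3 `GoldenThird`;
`min(m, q) ≤ m^{2/3} q^{1/3} ≤ (m² q)^{1/3} ≤ R^{1/3}`). -/
theorem third_of_uwHalf_qSideRad (h1 : UWHalf) (h2 : QSideRad) : GoldenExp (1 / 3) := by
  intro ε hε
  obtain ⟨κ₁, hκ₁⟩ := h1 ε hε
  obtain ⟨κ₂, hκ₂⟩ := h2 ε hε
  refine ⟨max (max (max κ₁ κ₂) 0) 0, fun u w huw h0 => ?_⟩
  have hA := hκ₁ u w huw h0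
  have hB := hκ₂ u w huw h0
  have hRabq := radR_eq huw
  generalize hR : (((radical (u * w * (u ^ 2 - 11 * u * w - w ^ 2))).natAbs : ℕ) : ℝ) = R at *
  generalize hq : (((radical (u ^ 2 - 11 * u * w - w ^ 2)).natAbs : ℕ) : ℝ) = q at *
  generalize ha : (((radical u).natAbs : ℕ) : ℝ) = a at *
  generalize hb : (((radical w).natAbs : ℕ) : ℝ) = b at *
  generalize hL : Real.log (max (|(u : ℝ)|) (|(w : ℝ)|)) = L at *
  have ha0 : 0 ≤ a := by rw [← ha]; exact Nat.cast_nonneg _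
  have hb0 : 0 ≤ b := by rw [← hb]; exact Nat.cast_nonneg _
  have hq0 : 0 ≤ q := by rw [← hq]; exact Nat.cast_nonneg _
  have hR0 : 0 ≤ R := by rw [← hR]; exact Nat.cast_nonneg _
  have hm0 : 0 ≤ min a b := le_min ha0 hb0
  have hRe : 0 ≤ R ^ (ε : ℝ) := Real.rpow_nonneg hR0 _
  set κ : ℝ := max (max κ₁ κ₂) 0 with hκ
  have hκ0 : 0 ≤ κ := le_max_right _ _
  have hA' : L ≤ κ * R ^ (ε : ℝ) * min a b :=
    hA.trans (mul_le_mul_of_nonneg_right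
      (mul_le_mul_of_nonneg_right ((le_max_left κ₁ κ₂).trans (le_max_left (max κ₁ κ₂) 0)) hRe) hm0)
  have hB' : L ≤ κ * R ^ (ε : ℝ) * q :=
    hB.trans (mul_le_mul_of_nonneg_right
      (mul_le_mul_of_nonneg_right ((le_max_right κ₁ κ₂).trans (le_max_left (max κ₁ κ₂) 0)) hRe) hq0)
  have hmin : L ≤ κ * R ^ (ε : ℝ) * min (min a b) q := by
    rcases le_total (min a b) q with h | h
    · rw [min_eq_left h]; exact hA'
    · rw [min_eq_right h]; exact hB'
  have hgeom : min (min a b) q ≤ (min a b) ^ (2 / 3 : ℝ) * q ^ (1 / 3 : ℝ) :=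
    min_le_geom hm0 hq0 (by norm_num) (by norm_num) (by norm_num)
  have hmm : min a b * min a b ≤ a * b :=
    mul_le_mul (min_le_left a b) (min_le_right a b) hm0 ha0
  have h23 : (min a b) ^ (2 / 3 : ℝ) ≤ (a * b) ^ (1 / 3 : ℝ) := by
    rw [show (2 / 3 : ℝ) = 2 * (1 / 3) by norm_num, Real.rpow_mul hm0,
      show (min a b) ^ (2 : ℝ) = min a b * min a b by rw [Real.rpow_two, sq]]
    exact Real.rpow_le_rpow (mul_nonneg hm0 hm0) hmm (by norm_num)
  have hX : min (min a b) q ≤ R ^ (1 / 3 : ℝ) := by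
    calc min (min a b) q ≤ (min a b) ^ (2 / 3 : ℝ) * q ^ (1 / 3 : ℝ) := hgeom
      _ ≤ (a * b) ^ (1 / 3 : ℝ) * q ^ (1 / 3 : ℝ) :=
          mul_le_mul_of_nonneg_right h23 (Real.rpow_nonneg hq0 _)
      _ = R ^ (1 / 3 : ℝ) := by
          rw [← Real.mul_rpow (mul_nonneg ha0 hb0) hq0, hRabq]
  exact exp_step hR0 (le_min hm0 hq0) hmin hX (by linarith)

/-! ## §3 Helper statements (sorried; sizes in the md).  T3 = the generic NF two-integer place bounds. -/

/-- **N1 (`approx_nf_arch`, M).** Number-field twin of `Pasten.approx_div`, archimedean clause: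
for a number field `K`, a fixed `α₀ ∈ K×` and an infinite place `w`, uniformly in nonzero integers
`u, v`: `−[K_w:ℝ]·log|u/(α₀v) − 1|_w ≤ A·C^{ω(uv)}·(∏_{p∣uv} log p)·log(2 log max(|u|,|v|) + 3)`.
Proof: `evertseGyory2022_prop_4_2_4_infinite_nf_of_matveev` with generators `(p : K)` (`p ∣ uv`,
`b_p = v_p(u) − v_p(v)`), `α₀` (`b = −1`), `−1` (sign / padding to `#κ ≥ 2`); `h((p:K))/d = log p`
(`BakerFieldG.logHeight₁_natCast_le`), `max(log p, m(d)) = log p`; `B = 2 log H + 3 ≥ max(3,|b|)`;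
`A = 12(16ed)^8 max(1,log d)² (2/log 2)·max(h(α₀)/d, m(d))·m(d)`, `C = (16ed)³`. -/
theorem approx_nf_arch (hM : matveev2000_linearFormsLog_nf)
    (K : Type) [Field K] [NumberField K] (α₀ : K) (hα₀ : α₀ ≠ 0) (w : InfinitePlace K) :
    ∃ A C : ℝ, 0 ≤ A ∧ 1 ≤ C ∧ ∀ u v : ℤ, u ≠ 0 → v ≠ 0 → (u : K) / (α₀ * v) ≠ 1 →
      -((w.mult : ℝ) * Real.log (w ((u : K) / (α₀ * v) - 1))) ≤
        A * C ^ (u * v).natAbs.primeFactors.card *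
          (∏ p ∈ (u * v).natAbs.primeFactors, Real.log p) *
          Real.log (2 * Real.log (max (|(u : ℝ)|) (|(v : ℝ)|)) + 3) := by
  sorry

/-- **N2 (`approx_nf_padic`, M).** Same, finite clause, uniformly in the prime `𝔭` of `K`:
`ord_𝔭(u/(α₀v) − 1)·log N𝔭 ≤ A·C^{ω(uv)}·(∏_{p∣uv} log p)·(N𝔭/log N𝔭)·log(2 log max(|u|,|v|) + 3)`.
Proof: `evertseGyory2022_prop_4_2_4_finite_nf_of_yu` with the same family and
`Literature.IUT.LogVolume.adicAbv_eq_absNorm_zpow`. -/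
theorem approx_nf_padic (hY : yu2007_padicLogForm_logB_nf)
    (K : Type) [Field K] [NumberField K] (α₀ : K) (hα₀ : α₀ ≠ 0) :
    ∃ A C : ℝ, 0 ≤ A ∧ 1 ≤ C ∧ ∀ (𝔭 : IsDedekindDomain.HeightOneSpectrum (𝓞 K)) (u v : ℤ),
      u ≠ 0 → v ≠ 0 → (u : K) / (α₀ * v) ≠ 1 →
      (Literature.IUT.LogVolume.ord K 𝔭 ((u : K) / (α₀ * v) - 1) : ℝ) *
          Real.log (Ideal.absNorm 𝔭.asIdeal : ℝ) ≤
        A * C ^ (u * v).natAbs.primeFactors.card *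
          (∏ p ∈ (u * v).natAbs.primeFactors, Real.log p) *
          ((Ideal.absNorm 𝔭.asIdeal : ℝ) / Real.log (Ideal.absNorm 𝔭.asIdeal : ℝ)) *
          Real.log (2 * Real.log (max (|(u : ℝ)|) (|(v : ℝ)|)) + 3) := by
  sorry

/-- **B1 (`sum_absNorm_le_radical_pow`, S).** GENERIC (any number field; this is what lets Level 1
skip the splitting lemma): the primes of `𝓞_K` containing a rational integer `n ≠ 0` have
`Σ N𝔭 ≤ rad(n)^{[K:ℚ]}`. Proof: `∏_{𝔭∈T} 𝔭 = ⊓_T 𝔭 ⊇ rad(n𝓞_K)`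
(`IsDedekindDomain.inf_prime_pow_eq_prod`, `Ideal.IsPrime.radical_le_iff`), so
`∏_T N𝔭 ∣ N(rad(n𝓞_K)) ≤ rad(n)^{[K:ℚ]}` (landed `GoldenFromNFPencil.absNorm_radical_span_intCast_le`),
and `Σ ≤ ∏` for terms `≥ 2`. -/
theorem sum_absNorm_le_radical_pow (K : Type) [Field K] [NumberField K] (n : ℤ) (hn : n ≠ 0)
    (T : Finset (IsDedekindDomain.HeightOneSpectrum (𝓞 K)))
    (hT : ∀ 𝔭 ∈ T, (n : 𝓞 K) ∈ 𝔭.asIdeal) :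
    ∑ 𝔭 ∈ T, Ideal.absNorm 𝔭.asIdeal ≤ (radical n).natAbs ^ Module.finrank ℚ K := by
  sorry

/-- **B2 (`sum_ord_mul_log_le_two_log`, S).** Product formula for the rational integer `Q` in a
quadratic field: for `T` any finite set of primes, `Σ_{𝔭∈T} ord_𝔭(Q)·log N𝔭 ≤ 2·log|Q|`
(`Literature.IUT.LogVolume.sum_ord_mul_logNorm_eq_sum_mult_log` at `f = (Q : K)`,
`Σ_w mult w = [K:ℚ]`, terms `≥ 0` by `ord_nonneg_of_isIntegral`). Stated for general `K`. -/
theorem sum_ord_mul_log_le (K : Type) [Field K] [NumberField K] (n : ℤ) (hn : n ≠ 0)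
    (T : Finset (IsDedekindDomain.HeightOneSpectrum (𝓞 K))) :
    ∑ 𝔭 ∈ T, (Literature.IUT.LogVolume.ord K 𝔭 (n : K) : ℝ) * Real.log (Ideal.absNorm 𝔭.asIdeal : ℝ) ≤
      (Module.finrank ℚ K : ℝ) * Real.log |(n : ℝ)| := by
  sorry

/-- **G3 (`not_mem_of_coprime`, XS).** Support disjointness: if `𝔭 ∋ u + β w` and `u, w` coprime
in `ℤ` then `𝔭 ∌ w` (else `𝔭 ∋ u`, `𝔭 ∋ 1`). Generic commutative ring. -/
theorem not_mem_of_coprime {S : Type} [CommRing S] (P : Ideal S) (hP : P ≠ ⊤) (β : S) {u w : ℤ}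
    (huw : IsCoprime u w) (hx : (u : S) + β * w ∈ P) : (w : S) ∉ P := by
  sorry

/-- **A1 (`real_trichotomy`, S).** Pure real analysis with `φ = (1+√5)/2`, `X₊ = u − φ⁵w`,
`X₋ = u + φ⁻⁵w` (`X₊X₋ = Q`, `X₋ − X₊ = 5√5·w`): either `H² ≤ 4|X₊X₋|` (regime `|w| < H/25`),
or `H ≤ 25|w|` and one of `H ≤ 2√5|X₋|`, `H ≤ 2√5|X₊|`. -/
theorem real_trichotomy (u w : ℝ) :
    let φ : ℝ := (1 + Real.sqrt 5) / 2
    let H : ℝ := max |u| |w|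
    H ^ 2 ≤ 4 * |(u - φ ^ 5 * w) * (u + φ⁻¹ ^ 5 * w)| ∨
      (H ≤ 25 * |w| ∧ H ≤ 2 * Real.sqrt 5 * |u + φ⁻¹ ^ 5 * w|) ∨
      (H ≤ 25 * |w| ∧ H ≤ 2 * Real.sqrt 5 * |u - φ ^ 5 * w|) := by
  sorry

/-- **A2 (`qNotSmallPre`, M; mod Matveev-NF only).** `2 log H ≤ log|Q| + Θ_K(uw)·log(2 log H + 3) + C₀`
with `Θ_K(uw) = A·C^{ω(uw)}·∏_{p∣uw} log p`. Proof: A1; in the two LFL regimes apply N1 in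
`K = ℚ(√5)` (`QuadraticAlgebra ℚ 1 1`, `GoldenField.*`) at the real place `σ(ω) = φ` with
`α₀ = ω⁵ = 3 + 5ω` resp. `α₀ = (1 − ω)⁵ = 8 − 5ω` (`σ`-images `φ⁵`, `−φ⁻⁵`; `mult = 1`):
`log|X₊| ≥ log|w| + 5 log φ − Θ L`, and `|X₊| = |Q|/|X₋| ≤ 2√5|Q|/H`, `|w| ≥ H/25`. -/
theorem qNotSmallPre (hM : matveev2000_linearFormsLog_nf) :
    ∃ A C C₀ : ℝ, 0 ≤ A ∧ 1 ≤ C ∧ ∀ u w : ℤ, IsCoprime u w → u * w * (u ^ 2 - 11 * u * w - w ^ 2) ≠ 0 →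
      2 * Real.log (max (|(u : ℝ)|) (|(w : ℝ)|)) ≤
        Real.log |((u ^ 2 - 11 * u * w - w ^ 2 : ℤ) : ℝ)| +
          A * C ^ (u * w).natAbs.primeFactors.card * (∏ p ∈ (u * w).natAbs.primeFactors, Real.log p) *
            Real.log (2 * Real.log (max (|(u : ℝ)|) (|(w : ℝ)|)) + 3) + C₀ := by
  sorry

/-- **P1 (`qUpperSqPre`, M; mod Yu-NF only; NO splitting lemma).**
`log|Q| ≤ Θ_K(uw)·rad(Q)²·log(2 log H + 3)/log 2`. Proof: B2 with `T = {𝔭 ∋ Q}`: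
`2 log|Q| = Σ_T ord_𝔭(Q) log N𝔭`; `ord_𝔭(Q) = ord_𝔭(x₊) + ord_𝔭(x̃₊)` (`x₊x̃₊ = Q`, landed
`GoldenFromNFPencil.formTwo_mul_formThree`); where `ord_𝔭(x₊) > 0`: `𝔭 ∌ w` (G3), `ω` a unit, so
`ord_𝔭(u/(ω⁵w) − 1) = ord_𝔭(x₊)` and N2 bounds the term by `Θ (N𝔭/log N𝔭) L`; likewise `x̃₊`;
then `Σ_T N𝔭/log N𝔭 ≤ (1/log 2) Σ_T N𝔭 ≤ rad(Q)²/log 2` (B1, `[K:ℚ] = 2`). -/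
theorem qUpperSqPre (hY : yu2007_padicLogForm_logB_nf) :
    ∃ A C : ℝ, 0 ≤ A ∧ 1 ≤ C ∧ ∀ u w : ℤ, IsCoprime u w → u * w * (u ^ 2 - 11 * u * w - w ^ 2) ≠ 0 →
      Real.log |((u ^ 2 - 11 * u * w - w ^ 2 : ℤ) : ℝ)| ≤
        A * C ^ (u * w).natAbs.primeFactors.card * (∏ p ∈ (u * w).natAbs.primeFactors, Real.log p) *
          (((radical (u ^ 2 - 11 * u * w - w ^ 2)).natAbs : ℕ) : ℝ) ^ 2 *
          Real.log (2 * Real.log (max (|(u : ℝ)|) (|(w : ℝ)|)) + 3) := by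
  sorry

/-- **E2 (absorption, S; = k2-g3 `exists_pow_card_primeFactors_le_mul_rpow` ∘
`exists_prod_log_primeFactors_le_mul_rpow`, reuse whichever lands).** `Θ(n) ≪_δ rad(n)^δ`. -/
theorem theta_le_rpow (A C δ : ℝ) (hA : 0 ≤ A) (hC : 1 ≤ C) (hδ : 0 < δ) :
    ∃ κ : ℝ, ∀ n : ℕ, n ≠ 0 →
      A * C ^ n.primeFactors.card * (∏ p ∈ n.primeFactors, Real.log p) ≤
        κ * ((radical n : ℕ) : ℝ) ^ (δ : ℝ) := by
  sorry

/-- **E1 (endgame / bootstrap, S; = k2-g3 L5 / k3-g3 Q1a shape).** `X ≤ M·log(2X + 3) + C₀` with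
`M ≥ 1` forces `X ≤ κ_η M^{1+η}`. -/
theorem endgame (η C₀ : ℝ) (hη : 0 < η) :
    ∃ κ : ℝ, ∀ X M : ℝ, 0 ≤ X → 1 ≤ M → X ≤ M * Real.log (2 * X + 3) + C₀ → X ≤ κ * M ^ (1 + η : ℝ) := by
  sorry

/-- **R-IIa target (S given A2, E1, E2).** `SmallQEps` from Matveev-NF alone:
on `|Q|² ≤ H`, A2 reads `(3/2) log H ≤ Θ L + C₀`. -/
theorem smallQEps_of_matveev (hM : matveev2000_linearFormsLog_nf) : SmallQEps := by
  sorry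

/-- **R-IIb target (S given P1, E1, E2).** `LargeQSq` from Yu-NF alone:
on `H ≤ |Q|²`, `log H ≤ 2 log|Q| ≤ 2·P1`. -/
theorem largeQSq_of_yu (hY : yu2007_padicLogForm_logB_nf) : LargeQSq := by
  sorry

/-- **The stub, PROVED-MOD-FACTS shape the lead should land** (`UWHalf` is unconditional). -/
theorem stub_of_facts (h0 : UWHalf) (hM : matveev2000_linearFormsLog_nf)
    (hY : yu2007_padicLogForm_logB_nf) : StubConjugate :=
  stub_of_uwHalf_qSideRadSq h0 (qSideRadSq_of_small_large (smallQEps_of_matveev hM) (largeQSq_of_yu hY))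

end Summit.ABC.ABC.Cruxes.GoldenCuspShadow.SideaK2G4

end
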